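import Summits.CriticalPhenomena.PercolationContinuityZ3.Theorems.PercNearOneGluingNoHeavyLowerTailFKCSHPeelDefs
import Summits.CriticalPhenomena.PercolationContinuityZ3.Theorems.PercNearOneGluingNoHeavyLowerTailCSHPeel
import Summits.CriticalPhenomena.PercolationContinuityZ3.Theorems.PercNearOneGluingNoHeavyLowerTailFKUpperChainGen
import HarnessLib

/-!
# FK sub-lane: (S5D) peeling under a general measure — TOOLS
# (the top-relay split of the ranked surplus, the `κ`-bound, the `covD` and `Ψ_iso` identities, with the measure as a parameter)

Support file (`--supports stmt-CriticalPhenomena-4575`), FK sub-lane `prim-bschramm-fk-1` (gen 2) of the post-continuity programme;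
builds on p205010 (kernel theorem, internal audit signed; external expert review pending).  No definitions, no named facts, no sorries;
standard axioms.  Line-by-line port of prim-hp-8's `…NoHeavyLowerTailCSHPeelTools.lean` (memo PROOF-S5-ALL-R.md §4, Lemmas P, κ, AC)
from `prodBernoulli w` to an arbitrary finite (resp. probability) measure `μ` on the bond configurations of `Fin n`, for the objects
`FK.surplusμ` / `FK.s5dMarginμ` / `FK.covDμ` / `FK.avoidConstμ` (fk-1's `…FKCSHPeelDefs.lean`, `…FKAnalogues.lean`).  The point: none of
these steps uses independence — only additivity of `μ` and (for `κ`) total mass one.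

* `FK.surplusμ_erase_add` — LEMMA P (core): for the rank-maximal relay `k` of `T`, `T' = T.erase k`, any `u`,
  `Sur_u(T) = Sur_u(T') + (∫_{D_k ∩ {k↔u}} F(C_k) dμ − μ(D_k ∩ {k↔u})·m_k)`, `D_k = {k ↮ T'}`;
* `FK.kappaμ_le_surplus` — LEMMA κ: `κ_k = m_k μ(D_k) − ∫_{D_k} F(C_k) dμ ≤ Sur_k(T')` when `m_k` is maximal (probability measure);
* `FK.covDμ_clusterFun_eq` — the top-relay term against `covDμ`;
* `FK.covDμ_psiIso` — `covDμ(k; T'; Ψ_iso)(u) = μ(D_k ∩ {C_k = ∅}) · μ(D_k ∩ {k↔u})` (`u ≠ k`).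
[cite: KozmaNitzan2024, Conj. 4 (p. 32)] [cite: VandenbergHaggstromKahn2005, Thm. 1.3 (p. 6)]
-/

noncomputable section

namespace Summit.CriticalPhenomena.PercolationContinuityZ3.Theorems

open MeasureTheory Set Literature.Probability.LatticeModels Literature.Probability.Percolation
open scoped Classical

namespace FK

open KNPreFKG

variable {n : ℕ}


/-- **LEMMA P (core) under `μ`: peeling the rank-maximal relay.**  For `k ∈ T` with `r a < r k` for all `a ∈ T.erase k`, and every
`u`, `Sur_u(T) = Sur_u(T.erase k) + (∫_{D_k ∩ {k↔u}} F(C_k) dμ − μ(D_k ∩ {k↔u})·m_k)`, `D_k = {k ↮ T.erase k}`, `m_k = ∫ F(C_k) dμ`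
(`CSH.surplus_erase_add` with `μ` for `prodBernoulli w`; pure bookkeeping of the first-in-rank patterns).
(transcription of the cell memo prim-hp-8 PROOF-S5-ALL-R.md §4.1, measure-parametrised) [cite: KozmaNitzan2024, Conj. 4 (p. 32)] -/
theorem surplusμ_erase_add (μ : Measure (BondConfig (Fin n))) [IsFiniteMeasure μ] (T : Finset (Fin n)) (r : Fin n → ℕ)
    (F : Set (Fin n) → ℝ) {k : Fin n} (hkT : k ∈ T) (hlt : ∀ a ∈ T.erase k, r a < r k) (u : Fin n) :
    surplusμ μ T r F u = surplusμ μ (T.erase k) r F u +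
      ((∫ ω in {ω : BondConfig (Fin n) | ∀ a ∈ (↑(T.erase k) : Set (Fin n)), ¬ (openGraph ω).Reachable k a} ∩ openConn k u,
          F (openCluster ω k) ∂μ) -
        μ.real ({ω : BondConfig (Fin n) | ∀ a ∈ (↑(T.erase k) : Set (Fin n)), ¬ (openGraph ω).Reachable k a} ∩
          openConn k u) * ∫ ω, F (openCluster ω k) ∂μ) := by
  classical
  set T' := T.erase k with hT'
  have hmeas : ∀ S : Set (BondConfig (Fin n)), MeasurableSet S := fun _ => MeasurableSet.of_discrete
  have hint : ∀ (g : BondConfig (Fin n) → ℝ) (S : Set (BondConfig (Fin n))), IntegrableOn g S μ :=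
    fun g S => (Integrable.of_finite).integrableOn
  set f₀ : BondConfig (Fin n) → ℝ := fun ω => F (openCluster ω u) with hf₀
  set fk : BondConfig (Fin n) → ℝ := fun ω => F (openCluster ω k) with hfk
  set UT : Set (BondConfig (Fin n)) := ⋃ a ∈ T', openConn u a with hUT
  set Ok : Set (BondConfig (Fin n)) := openConn u k with hOk
  set Dk : Set (BondConfig (Fin n)) := {ω : BondConfig (Fin n) | ∀ a ∈ (↑T' : Set (Fin n)), ¬ (openGraph ω).Reachable k a} with hDk
  have hfiltT : ∀ a ∈ T', T.filter (fun a' => r a' < r a) = T'.filter (fun a' => r a' < r a) := by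
    intro a ha
    rw [hT', AGloc.filter_erase_of_not]
    exact fun h => lt_asymm h (hlt a ha)
  have hfiltk : T.filter (fun a' => r a' < r k) = T' := by
    ext a
    simp only [Finset.mem_filter, hT', Finset.mem_erase]
    constructor
    · rintro ⟨ha, h⟩; exact ⟨fun hak => lt_irrefl _ (hak ▸ h), ha⟩
    · rintro ⟨hak, ha⟩; exact ⟨ha, hlt a (Finset.mem_erase.2 ⟨hak, ha⟩)⟩
  have hPk : (openConn u k ∩ ⋂ a' ∈ T.filter (fun a' => r a' < r k), (openConn u a')ᶜ : Set (BondConfig (Fin n))) =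
      Dk ∩ openConn k u := by
    rw [hfiltk]
    ext ω
    simp only [hDk, mem_inter_iff, mem_iInter, mem_compl_iff, openConn, mem_setOf_eq, Finset.mem_coe]
    constructor
    · rintro ⟨hk', h⟩
      exact ⟨fun a ha hka => h a ha (hk'.trans hka), hk'.symm⟩
    · rintro ⟨h, hk'⟩
      exact ⟨hk'.symm, fun a ha hoa => h a ha (hk'.trans hoa)⟩
  have hsumT : ∑ a ∈ T, μ.real (openConn u a ∩ ⋂ a' ∈ T.filter (fun a' => r a' < r a), (openConn u a')ᶜ : Set (BondConfig (Fin n))) *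
        ∫ ω, F (openCluster ω a) ∂μ =
      ∑ a ∈ T', μ.real (openConn u a ∩ ⋂ a' ∈ T'.filter (fun a' => r a' < r a), (openConn u a')ᶜ : Set (BondConfig (Fin n))) *
        ∫ ω, F (openCluster ω a) ∂μ + μ.real (Dk ∩ openConn k u) * ∫ ω, fk ω ∂μ := by
    rw [← Finset.add_sum_erase T _ hkT, hPk, add_comm]
    congr 1
    refine Finset.sum_congr rfl fun a ha => ?_
    rw [hfiltT a ha]
  have hUA : (⋃ a ∈ T, (openConn u a : Set (BondConfig (Fin n)))) = UT ∪ Ok := by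
    ext ω
    simp only [hUT, hOk, mem_iUnion, mem_union, exists_prop, hT', Finset.mem_erase]
    constructor
    · rintro ⟨a, ha, h⟩
      by_cases hak : a = k
      · exact Or.inr (hak ▸ h)
      · exact Or.inl ⟨a, ⟨hak, ha⟩, h⟩
    · rintro (⟨a, ⟨_, ha⟩, h⟩ | h)
      · exact ⟨a, ha, h⟩
      · exact ⟨k, hkT, h⟩
  have h0k : ∀ ω ∈ Dk ∩ openConn k u, f₀ ω = fk ω := fun ω hω => by
    simp only [hf₀, hfk]
    rw [openCluster_eq_of_reachable ((hω.2 : (openGraph ω).Reachable k u).symm)]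
  have hdiff : (UT ∪ Ok) \ UT = Dk ∩ openConn k u := by
    ext ω
    simp only [hUT, hOk, hDk, mem_sdiff, mem_union, mem_iUnion, mem_inter_iff, exists_prop, not_exists, not_and, openConn,
      mem_setOf_eq, Finset.mem_coe]
    constructor
    · rintro ⟨h | h, hno⟩
      · obtain ⟨a, ha, h'⟩ := h; exact absurd h' (hno a ha)
      · exact ⟨fun a ha hka => hno a ha (h.trans hka), h.symm⟩
    · rintro ⟨hd, hk'⟩
      exact ⟨Or.inr hk'.symm, fun a ha hoa => hd a ha (hk'.trans hoa)⟩
  have hsplit : ∫ ω in UT ∪ Ok, f₀ ω ∂μ = ∫ ω in UT, f₀ ω ∂μ + ∫ ω in Dk ∩ openConn k u, fk ω ∂μ := by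
    rw [← integral_inter_add_sdiff (hmeas UT) (hint f₀ (UT ∪ Ok)), inter_eq_right.2 subset_union_left, hdiff,
      setIntegral_congr_fun (hmeas _) fun ω hω => h0k ω hω]
  unfold surplusμ
  rw [hsumT, hUA, hsplit]
  ring

/-- **LEMMA κ under a probability measure `μ`**: with `D_k = {k ↮ T'}` and `m_k = ∫ F(C_k) dμ` maximal on `T' ∪ {k}` (`m_a ≤ m_k` for
`a ∈ T'`), the deficit `κ_k = m_k·μ(D_k) − ∫_{D_k} F(C_k) dμ` is at most `Sur_k(T')` (`CSH.kappa_le_surplus` with `μ`; uses only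
`Σ_a μ(P^k_a) = μ(k ↔ T')`, fk-2's `FK.sum_measureReal_firstRank_under`).
(transcription of the cell memo prim-hp-8 PROOF-S5-ALL-R.md §4.2, measure-parametrised) [cite: KozmaNitzan2024, Conj. 4 (p. 32)] -/
theorem kappaμ_le_surplus (μ : Measure (BondConfig (Fin n))) [IsProbabilityMeasure μ] (T' : Finset (Fin n)) (r : Fin n → ℕ)
    (F : Set (Fin n) → ℝ) (k : Fin n) (hrT : Set.InjOn r ↑T')
    (hmle : ∀ a ∈ T', ∫ ω, F (openCluster ω a) ∂μ ≤ ∫ ω, F (openCluster ω k) ∂μ) :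
    (∫ ω, F (openCluster ω k) ∂μ) * μ.real {ω : BondConfig (Fin n) | ∀ a ∈ (↑T' : Set (Fin n)), ¬ (openGraph ω).Reachable k a} -
      ∫ ω in {ω : BondConfig (Fin n) | ∀ a ∈ (↑T' : Set (Fin n)), ¬ (openGraph ω).Reachable k a}, F (openCluster ω k) ∂μ ≤
      surplusμ μ T' r F k := by
  classical
  have hmeas : ∀ S : Set (BondConfig (Fin n)), MeasurableSet S := fun _ => MeasurableSet.of_discrete
  have hn := fun (S : Set (BondConfig (Fin n))) => (measureReal_nonneg : 0 ≤ μ.real S)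
  set fk : BondConfig (Fin n) → ℝ := fun ω => F (openCluster ω k) with hfk
  set mk : ℝ := ∫ ω, fk ω ∂μ with hmk
  set Dk : Set (BondConfig (Fin n)) := {ω : BondConfig (Fin n) | ∀ a ∈ (↑T' : Set (Fin n)), ¬ (openGraph ω).Reachable k a} with hDk
  set Wk : Set (BondConfig (Fin n)) := ⋃ a ∈ T', openConn k a with hWk
  have hDW : Dk = Wkᶜ := by
    ext ω
    simp [hDk, hWk, openConn]
  have hDint : ∫ ω in Dk, fk ω ∂μ = mk - ∫ ω in Wk, fk ω ∂μ := by
    have := integral_add_compl (hmeas Wk) (Integrable.of_finite (f := fk) (μ := μ))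
    rw [← hDW] at this
    linarith
  have hDμ : μ.real Dk = 1 - μ.real Wk := by
    have h1 : μ.real (univ : Set (BondConfig (Fin n))) = μ.real (univ ∩ Wk) + μ.real (univ \ Wk) :=
      (measureReal_inter_add_sdiff (s := univ) (h := measure_ne_top _ _) (hmeas Wk)).symm
    rw [probReal_univ, univ_inter, ← compl_eq_univ_sdiff, ← hDW] at h1
    linarith
  have hWsum : ∑ a ∈ T', μ.real (openConn k a ∩ ⋂ a' ∈ T'.filter (fun a' => r a' < r a), (openConn k a')ᶜ : Set (BondConfig (Fin n))) =
      μ.real Wk := sum_measureReal_firstRank_under μ T' r k hrT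
  have hsum : ∑ a ∈ T', μ.real (openConn k a ∩ ⋂ a' ∈ T'.filter (fun a' => r a' < r a), (openConn k a')ᶜ : Set (BondConfig (Fin n))) *
        ∫ ω, F (openCluster ω a) ∂μ ≤ mk * μ.real Wk := by
    have : ∑ a ∈ T', μ.real (openConn k a ∩ ⋂ a' ∈ T'.filter (fun a' => r a' < r a), (openConn k a')ᶜ : Set (BondConfig (Fin n))) *
        ∫ ω, F (openCluster ω a) ∂μ ≤
        ∑ a ∈ T', μ.real (openConn k a ∩ ⋂ a' ∈ T'.filter (fun a' => r a' < r a), (openConn k a')ᶜ : Set (BondConfig (Fin n))) * mk :=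
      Finset.sum_le_sum fun a ha => mul_le_mul_of_nonneg_left (hmle a ha) (hn _)
    rw [← Finset.sum_mul, hWsum] at this
    linarith
  unfold surplusμ
  rw [hDint, hDμ]
  change mk * (1 - μ.real Wk) - (mk - ∫ ω in Wk, fk ω ∂μ) ≤ (∫ ω in Wk, fk ω ∂μ) - _
  linarith

/-- **The top-relay term against `covDμ`** (`CSH.covD_clusterFun_eq` with `μ`): with `F̂(C) = F(span_k C)` (so `F̂(C_k) = F(C(k))`),
`D_k = {k ↮ T'}`, `κ_k = m_k μ(D_k) − ∫_{D_k} F(C_k) dμ`: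
`μ(D_k)·(∫_{D_k∩{k↔u}} F(C_k) dμ − μ(D_k∩{k↔u}) m_k) = covDμ(k; T'; F̂)(u) − κ_k·μ(D_k ∩ {k↔u})` (pure algebra).
(transcription of the cell memo prim-hp-8 PROOF-S5-ALL-R.md §4.1, measure-parametrised) [folklore] -/
theorem covDμ_clusterFun_eq (μ : Measure (BondConfig (Fin n))) (T' : Finset (Fin n)) (F : Set (Fin n) → ℝ) (k u : Fin n) :
    μ.real {ω : BondConfig (Fin n) | ∀ a ∈ (↑T' : Set (Fin n)), ¬ (openGraph ω).Reachable k a} *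
        ((∫ ω in {ω : BondConfig (Fin n) | ∀ a ∈ (↑T' : Set (Fin n)), ¬ (openGraph ω).Reachable k a} ∩ openConn k u,
            F (openCluster ω k) ∂μ) -
          μ.real ({ω : BondConfig (Fin n) | ∀ a ∈ (↑T' : Set (Fin n)), ¬ (openGraph ω).Reachable k a} ∩ openConn k u) *
            ∫ ω, F (openCluster ω k) ∂μ) =
      covDμ μ k (↑T' : Set (Fin n)) (fun C => F {a | a = k ∨ ∃ e ∈ C, a ∈ e}) u -
        ((∫ ω, F (openCluster ω k) ∂μ) * μ.real {ω : BondConfig (Fin n) | ∀ a ∈ (↑T' : Set (Fin n)), ¬ (openGraph ω).Reachable k a} -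
          ∫ ω in {ω : BondConfig (Fin n) | ∀ a ∈ (↑T' : Set (Fin n)), ¬ (openGraph ω).Reachable k a}, F (openCluster ω k) ∂μ) *
        μ.real ({ω : BondConfig (Fin n) | ∀ a ∈ (↑T' : Set (Fin n)), ¬ (openGraph ω).Reachable k a} ∩ openConn k u) := by
  unfold covDμ
  simp only [clusterFun_openEdgeCluster, Finset.mem_coe]
  ring

/-- **The `Ψ_iso` identity behind LEMMA AC, under `μ`** (`CSH.covD_psiIso` with `μ`): for `u ≠ k`,
`covDμ(k; T'; Ψ_iso)(u) = μ(D_k ∩ {C_k = ∅}) · μ(D_k ∩ {k↔u})`, `Ψ_iso = 1{C ≠ ∅}` (`CSH.psiIso`).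
(transcription of the cell memo prim-hp-8 PROOF-S5-ALL-R.md §4.3, measure-parametrised) [folklore] -/
theorem covDμ_psiIso (μ : Measure (BondConfig (Fin n))) [IsFiniteMeasure μ] (T' : Finset (Fin n)) (k u : Fin n) (huk : u ≠ k) :
    covDμ μ k (↑T' : Set (Fin n)) CSH.psiIso u =
      μ.real ({ω : BondConfig (Fin n) | ∀ a ∈ (↑T' : Set (Fin n)), ¬ (openGraph ω).Reachable k a} ∩ {ω | openEdgeCluster ω k = ∅}) *
        μ.real ({ω : BondConfig (Fin n) | ∀ a ∈ (↑T' : Set (Fin n)), ¬ (openGraph ω).Reachable k a} ∩ openConn k u) := by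
  classical
  have hmeas : ∀ S : Set (BondConfig (Fin n)), MeasurableSet S := fun _ => MeasurableSet.of_discrete
  set Dk : Set (BondConfig (Fin n)) := {ω : BondConfig (Fin n) | ∀ a ∈ (↑T' : Set (Fin n)), ¬ (openGraph ω).Reachable k a} with hDk
  have h1 : ∫ ω in Dk ∩ openConn k u, CSH.psiIso (openEdgeCluster ω k) ∂μ = μ.real (Dk ∩ openConn k u) := by
    rw [setIntegral_congr_fun (hmeas _) (fun ω hω => CSH.psiIso_eq_one_of_reachable huk hω.2), setIntegral_const, smul_eq_mul,
      mul_one]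
  have h2 : ∫ ω in Dk, CSH.psiIso (openEdgeCluster ω k) ∂μ = μ.real Dk - μ.real (Dk ∩ {ω | openEdgeCluster ω k = ∅}) := by
    have hsplit := (integral_inter_add_sdiff (hmeas {ω : BondConfig (Fin n) | openEdgeCluster ω k = ∅})
      ((Integrable.of_finite (f := fun ω => CSH.psiIso (openEdgeCluster ω k)) (μ := μ)).integrableOn (s := Dk))).symm
    rw [hsplit]
    have ha : ∫ ω in Dk ∩ {ω | openEdgeCluster ω k = ∅}, CSH.psiIso (openEdgeCluster ω k) ∂μ = 0 := by
      rw [setIntegral_congr_fun (hmeas _) (fun ω hω => by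
        show CSH.psiIso (openEdgeCluster ω k) = (0 : ℝ)
        unfold CSH.psiIso; rw [if_pos (show openEdgeCluster ω k = ∅ from hω.2)])]
      simp
    have hb : ∫ ω in Dk \ {ω | openEdgeCluster ω k = ∅}, CSH.psiIso (openEdgeCluster ω k) ∂μ =
        μ.real (Dk \ {ω | openEdgeCluster ω k = ∅}) := by
      rw [setIntegral_congr_fun (hmeas _) (fun ω hω => by
        show CSH.psiIso (openEdgeCluster ω k) = (1 : ℝ)
        unfold CSH.psiIso; rw [if_neg (show ¬ (openEdgeCluster ω k = ∅) from hω.2)]), setIntegral_const, smul_eq_mul, mul_one]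
    rw [ha, hb, zero_add]
    have := measureReal_inter_add_sdiff (μ := μ) (s := Dk) (h := measure_ne_top _ _)
      (hmeas {ω : BondConfig (Fin n) | openEdgeCluster ω k = ∅})
    linarith
  unfold covDμ
  simp only [Finset.mem_coe] at hDk ⊢
  rw [← hDk, h1, h2]
  ring

end FK

end Summit.CriticalPhenomena.PercolationContinuityZ3.Theorems

end
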